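import Mathlib
import Summits.Ventures.HodgeRepro2.T6N5Skeleton
import Summits.Ventures.HodgeRepro2.T6N5LocalDatum
import Summits.Ventures.HodgeRepro2.T6N5LocalHyp
import Summits.Ventures.HodgeRepro2.T6N5Local

/-!
# T6N5LocalToy — Tier 6, M2 sub-step N5 (t6-p8's half): the non-vacuity witness for `T6N5Local`
(README §10.5(ii)(c),(d))

A toy local sign datum `toyLocal η₀ η₁ u` (characters = `ℤˣ × ℤˣ`, restriction = the first coordinate, root number
= the second coordinate, so that BOTH sign classes are non-empty) on which the display `Hyp.BFGYYZ2025_Thm3_5`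
and every binder of `N5Local_main` (hA1, hW, hη, hχW and the residual `hiii`) hold jointly, for every choice of
the line symbols `ω(λ_a) = η₀`, `ω(λ_b) = η₁` and `η_v(u) = u` — so the hypotheses are not refutable, none is
closed by `trivial`, and `N5Local_main` applies on the toy (`toyLocal_solution`).
README §8(d): uses an L-value-free non-vanishing device: NO.
-/

namespace Summit.Ventures.HodgeRepro2.T6.N5LocalToy

open Summit.Ventures.HodgeRepro2.T6.N5LocalDatum Summit.Ventures.HodgeRepro2.T6.N5Local
  Summit.Ventures.HodgeRepro2.T6.Hyp

/-- The toy local sign datum (an `abbrev`, so that its fields reduce). -/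
abbrev toyLocal (η₀ η₁ u : ℤˣ) : LocalSignDatum where
  Char := ℤˣ × ℤˣ
  FChar := ℤˣ
  res := MonoidHom.fst ℤˣ ℤˣ
  η := -1
  eps := fun ξ => ξ.2
  χW := (-1, 1)
  epsdW := 1
  Theta := fun s α => α.2 = s
  ηLine := ![η₀, η₁]
  ηu := u

variable (η₀ η₁ u : ℤˣ)

/-- The display holds on the toy. -/
theorem toy_thm3_5 : BFGYYZ2025_Thm3_5 (toyLocal η₀ η₁ u) := by
  intro s α _
  show α.2 = s ↔ ((-1, 1) : ℤˣ × ℤˣ)⁻¹.2 * α.2 = s * 1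
  simp

/-- (A1) on the toy: for each sign `s` the character `(1, s)` is conjugate-orthogonal and occurs. -/
theorem toy_hA1 : ∀ s : ℤˣ, ∃ α : (toyLocal η₀ η₁ u).Char, (toyLocal η₀ η₁ u).IsCO α ∧
    (toyLocal η₀ η₁ u).Theta s α :=
  fun s => ⟨(1, s), rfl, rfl⟩

/-- The residual binder `hiii` (case (iii) of Theorem N5.T2, pair form) holds on the toy: with `s := η₀`,
`a := (−1, s)` and `c := (−1, −s)` give `c⁻¹·a² = (−1, −s)`. -/
theorem toy_hiii : (toyLocal η₀ η₁ u).ηu = -1 → (toyLocal η₀ η₁ u).ηLine 0 = (toyLocal η₀ η₁ u).ηLine 1 →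
    ∃ a c : (toyLocal η₀ η₁ u).Char, (toyLocal η₀ η₁ u).IsCS a ∧ (toyLocal η₀ η₁ u).IsCS c ∧
      (toyLocal η₀ η₁ u).eps a = (toyLocal η₀ η₁ u).ηLine 0 ∧
      (toyLocal η₀ η₁ u).eps c = -(toyLocal η₀ η₁ u).ηLine 0 ∧
      (toyLocal η₀ η₁ u).eps (c⁻¹ * a * a) = -(toyLocal η₀ η₁ u).ηLine 0 := by
  intro _ _
  refine ⟨(-1, η₀), (-1, -η₀), rfl, rfl, rfl, rfl, ?_⟩
  show ((-1 : ℤˣ), -η₀)⁻¹.2 * η₀ * η₀ = -η₀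
  simp

/-- All binders of `N5Local_main` hold jointly on the toy, hence Theorem N5.T2's conclusion holds there
(README §10.5(ii)(d): the hypothesis set is satisfiable). -/
theorem toyLocal_solution : ∃ ξ : Fin 4 → (toyLocal η₀ η₁ u).Char, LocalSolution (toyLocal η₀ η₁ u) ξ :=
  N5Local_main (toyLocal η₀ η₁ u) (toy_thm3_5 η₀ η₁ u) (toy_hA1 η₀ η₁ u) rfl rfl rfl (toy_hiii η₀ η₁ u)

end Summit.Ventures.HodgeRepro2.T6.N5LocalToy
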